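import Literature.MathematicalPhysics.QuantumFieldTheory.Balaban1983to89.Node00.N24NodesStage12PointedAll
import Literature.MathematicalPhysics.QuantumFieldTheory.Balaban1983to89.B16RLeafRecord12AtLive

/-!
# NODE N24 · THE CLOSER'S POINTED FORMS ON THE K0′ WITNESS LINE — AT A LIVE RE-PIN `θ.liveRepin` (node00-def-K0a) AND AT THE RE-PINNED WITNESS `θ₀ˡⁱᵛᵉ =
# theta12LiveOfRecord F N ζ Rz Zt`: N13's 𝐑-HALF (R₁₂) IS A THEOREM THERE (seat dag-n11-e's `B16RLeafRecord12AtLive`: 𝐑 of record = identity a.e., the sign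
# `0 ≤ g_{k+1}` free), `Admissible` and `SlotsNondegenerate` ARE THEOREMS THERE (K0a) — what N24 still displays on that line is: the provisos `Provisos₁₂` at the
# re-pin (= K0′'s own residual), `ZtUnity` (a theorem at K0b's residuals of record), the residual-carrier leaves, (S1ᵀ), (UV₁₂) and the β-box pair

TRACK A (YM-PLAN §2d, node N24 of 28 = binder B2 `hB : B16.EndStatementBPrinted D.C`), seat `pub-ymgap-dag-n24-c` (R134 fan-out seat, strategy s2; gen 3; g2 HANDOFF trigger (t2)
executed by modules 30–33; THIS module = the first consumer junction with the K0′ witness line).  THIRTY-FOURTH N24 module, a NEW importing one (modules 1–33 untouched;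
imports module 32 `N24NodesStage12PointedAll` and seat dag-n11-e's `B16RLeafRecord12AtLive`, hence node00-def-K0a's `Node00/Record12LiveSelector(Torus)`).  THEOREMS ONLY,
def-free, sorry-free, standard axioms.

BY NAME AND UNCHANGED: module 32's `N24_nodes₁₂_pointed_all` ∕ `N24_endStatementBPrinted₁₂_pointed_all` ∕ `N24_stabilityBR12e_thetaShape15_pointed_all` (every child at the
presentation's objects; N13 = (R₁₂) `hR` + (UV₁₂) `hUV`); node00-def-K0a's `Stage12Params.liveRepin` (the selector re-pinned to the LIVE selector of record, director-ym LINE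
№114 (α)), `Stage12Params.Admissible.liveRepin`, `Stage12Params.ZtUnity.liveRepin`, `Stage12Params.slotsNondegenerate_liveRepin` (v2.3-guarded `SlotsNondegenerate` at a live
re-pin FROM `Provisos₁₀` OF THE RE-PIN — the `base` field of `Provisos₁₂`), `theta12LiveOfRecord` (= `(theta12OfRecord …).liveRepin`, `rfl`), `admissible_theta12OfRecord`,
`ztUnity_theta12LiveOfRecord` (at K0b's residuals of record); seat dag-n11-e's `B16RLeafRecord12AtLive.rOpLeaf_VOfRecord₁₂_liveRepin_signFree` (★ the 𝐑-leaf of record at a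
live re-pin from the provisos at the re-pin, admissibility and the term-constant signs of `θ` — `0 ≤ g_{k+1}` discharged by `gOfRecord₁₀_succ_nonneg`),
`kappa_nonneg_theta12OfRecord` ∕ `E0_nonneg_…` ∕ `B0_nonneg_…` (the signs at `θ₀`); def-T's `rOpLeaf_VOfRecord₁₂_iff` (leaf ↔ law transport).

WHAT THIS FILE PROVES.
§1 AT ANY LIVE RE-PIN `θ.liveRepin` (`θ` admissible, signs `0 ≤ κ, E₀, B₀` displayed): `N24_nodes₁₂_pointed_all_liveRepin` (the thirteen nodes at a world bound to the
   re-pin's datum from the pointed children — N13's `hR` GONE), `N24_endStatementBPrinted₁₂_pointed_all_liveRepin` ((B2) at the re-pin's datum),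
   **`N24_stabilityBR12e_thetaShape15_pointed_all_liveRepin`** (K1′'s rev-15 consequent witnessed by `(θ.liveRepin, hP)`: the guard's `SlotsNondegenerate` DISCHARGED from
   `hP.base`, `ZtUnity` displayed as `hZ : θ.ZtUnity F N`).
§2 AT `θ₀ˡⁱᵛᵉ = theta12LiveOfRecord F N ζ Rz Zt` (every choice of the residual objects; admissibility and signs are theorems of the numerics of record):
   `N24_nodes₁₂_pointed_all_theta12Live`, `N24_nodesAtSomeRecord₁₂_of_pointed_all_theta12Live` (the body of `NodesAtSomeRecord12`, `hZ` displayed),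
   **`N24_stabilityBR12e_thetaShape15_pointed_all_theta12Live`** (`hZ : θ₀ˡⁱᵛᵉ.ZtUnity` displayed — at K0b's residuals of record `(zeta316OfRecord, RzOfRecord, ZtOfRecord)` it is
   node00-def-K0a's theorem `ztUnity_theta12LiveOfRecord`; see HONEST SCOPE for why that instance is not singled out here).

WHICH CHILD BLOCKS ON THE K0′ WITNESS LINE (kernel form = the hypothesis list of §2's last theorem): `hP : Provisos₁₂` at `θ₀ˡⁱᵛᵉ` (= what is left of K0′
`Record12Inhabited` at this witness, K0a's `exists_k0prime_of_theta12Live_of_provisos₁₂`) and `hZ : ZtUnity`; a world bound to the datum (the closer's letters, `N24_exists_boundWorld₁₂`); N05 [B8]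
residual leaf · N06 def-Y's leaf · N07 [B11] leaf · N08 leaf-system form · N12 [IV] leaf — all at `θ₀ˡⁱᵛᵉ.res` (the residual groups of the witness); N09 own Lemma-4 leaf + [B11]
Thm 1 ×3 at `domAltOfRecord F N numerics7OfRecord₁₂ P.K k`; N10 B13 socket; N11 (S1ᵀ) at `θ₀ˡⁱᵛᵉ`; N13 (UV₁₂) ONLY ((R₁₂) is a theorem here); β-box pair on
`(datumOfRecord₁₂ θ₀ˡⁱᵛᵉ hP).βfun` (β⁺ [I] (1.22) p. 264; `b > 0` NODE O, UNPRINTED).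
HONEST SCOPE.  On the live-re-pin branch 𝐑 of record integrates nothing out of a live term («𝐑 = identity a.e.», dag-n11-e's header): [Balaban1989LargeFieldII] Thm 1's
𝐑-construction is NOT exercised and N13 is NOT discharged — its (UV₁₂) half stays displayed, and the (R₁₂) half holds BY THE SHAPE OF THE WITNESS.  At K0b's residuals
of record (uniform `ζ0`) seat dag-n11-d's READING (pub-ymgap INBOX l.14524) expects the (S1ᵀ) hypothesis to FAIL, so no corollary is stated at that instance; the
general-`(ζ, Rz, Zt)` forms are the ones for the K1′ witness-to-be.  Kernel bookkeeping BY NAME; nothing of Bałaban's asserted; every slot DISPLAYED; N24 COMPOSITE — no discharge, no count, no stub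
closed; one finite T⁴ programme at fixed ε; NOT continuum ∕ ℝ⁴ ∕ OS ∕ mass gap ∕ Clay.
-/

noncomputable section

open scoped Matrix.Norms.L2Operator

namespace Literature.MathematicalPhysics.QuantumFieldTheory.Balaban1983to89.Node00

open DagBinding T4Continuum T4DatumAssembly FlowStepRuns AveragingRT
open FlowStep (BetaLowerH BetaUpperH)
open B16RLeafRecord12AtLive (rOpLeaf_VOfRecord₁₂_liveRepin_signFree kappa_nonneg_theta12OfRecord E0_nonneg_theta12OfRecord B0_nonneg_theta12OfRecord)

variable {F : T4Family} {N : ℕ} [NeZero N]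

/-! ## §1. At any live re-pin `θ.liveRepin`: N13's 𝐑-half is a theorem, the guard's `SlotsNondegenerate` is a theorem -/

/-- **N24 · THE THIRTEEN DAG NODES AT A WORLD BOUND TO THE DATUM OF A LIVE RE-PIN `θ.liveRepin`, FROM THE POINTED CHILDREN — N13's (R₁₂) DISCHARGED BY NAME**
(module 32's `N24_nodes₁₂_pointed_all` at `θ.liveRepin` with `hR := rOpLeaf_VOfRecord₁₂_liveRepin_signFree` read through `rOpLeaf_VOfRecord₁₂_iff`): displayed — the provisos
`hP` AT THE RE-PIN, `θ`'s admissibility and term-constant signs, the world binding, N05 ∕ N06 ∕ N07 ∕ N08 ∕ N12 leaves at the re-pin's residual groups (= `θ`'s), N09's own leaf +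
[Balaban1985Variational] Thm 1 ×3, N10's B13 socket, N11's (S1ᵀ) at the re-pin, N13's (UV₁₂) at the re-pin's densities of record.
[cite: Balaban1989LargeFieldII, Thm 1 p.355 (its 𝐑-construction not exercised on this branch), (0.1) pp.355–356, p.387, p.391; Balaban1988Convergent, Thm 1 p.262, Theorem p.245, p.244, Thm 2 p.263, Cor. 3 (2.50) p.264; Balaban1989LargeFieldI, (0.3) p.176, p.177 (i)–(ii); Balaban1987RG1, Thm 1 p.259, Thm 3 p.264, Lemma 4 (3.53) p.280, (0.20) p.256; Balaban1985Variational, Thm 1 (8)–(10) p.279; Balaban1985RegularSpaces, Thms 2, 4, 8 pp.83–101; Balaban1985BackgroundPropagators, Thms 3.1–3.15 pp.397–432; Balaban1985UV3, Thm 1 p.257 + Thm 2 p.272; Balaban1988RG2Cluster, Lemmas 1–3 pp.9, 11, 20 (node bookkeeping at the re-pinned presentation)] -/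
theorem N24_nodes₁₂_pointed_all_liveRepin (θ : Stage12Params F N) (hP : (θ.liveRepin F N).Provisos₁₂ F N) (hθ : θ.Admissible F N)
    (hκ : 0 ≤ θ.s2.lf.κ) (hE₀ : 0 ≤ θ.s2.lf.E₀) (hB₀ : 0 ≤ θ.s2.lf.B₀) (w : WorldP)
    (hC : w.C = (datumOfRecord₁₂ F N (θ.liveRepin F N) hP).C) (hγ : 0 < w.γ ∧ w.γ ≤ (θ.liveRepin F N).γ) (hL : w.L = ((θ.liveRepin F N).L : ℝ))
    (hup : ∀ P, w.up P = upOfRecord₅C F N ((θ.liveRepin F N).toStage5₁₂ F N) P)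
    (h05 : ∀ P : B12.RunParams,
      B8LeafR ((θ.liveRepin F N).res.X P).d8 ((θ.liveRepin F N).res.X P).L8 ((θ.liveRepin F N).res.X P).C₂ ((θ.liveRepin F N).res.X P).B₁'
        ((θ.liveRepin F N).res.X P).B₀' ((θ.liveRepin F N).res.X P).B₁ ((θ.liveRepin F N).res.X P).B₂ ((θ.liveRepin F N).res.X P).c₁
        ((θ.liveRepin F N).res.X P).inp8 ((θ.liveRepin F N).res.X P).B₀β ((θ.liveRepin F N).res.X P).loc8 ((θ.liveRepin F N).res.X P).fam8R
        ((θ.liveRepin F N).res.X P).lan8 ((θ.liveRepin F N).res.X P).cub8 ((θ.liveRepin F N).res.X P).toAxial8)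
    (h06 : ∀ P : B12.RunParams, B9LeafX ((θ.liveRepin F N).res.Y P))
    (h07 : ∀ P : B12.RunParams, B11Leaf ((θ.liveRepin F N).res.Z P))
    (h08 : ∀ P : B12.RunParams, ∃ (Xc : PrintedCarriersR) (I : Type) (C : B10Assembly.Consts) (T : I → B10.TowerRun),
      Nonempty (∀ i, B10Assembly.LeafSystem C (T i)) ∧ (θ.liveRepin F N).res.X P = Xc.withTowerRuns10 T)
    (h09 : ∀ P : B12.RunParams, B12Sec2to5.Lemma4Printed ((θ.liveRepin F N).res.X P).F12 ((θ.liveRepin F N).res.X P).c12)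
    (h11dom : ∀ (P : B12.RunParams) (k : ℕ), k ≤ P.K →
      ∀ V ∈ domAltOfRecord F N (θ.liveRepin F N).ν P.K k, UkExists F N P.K k (θ.liveRepin F N).εbg V ∧ UniqueUkOrbit F N P.K k (θ.liveRepin F N).εbg V)
    (hres : ∀ (P : B12.RunParams) (k : ℕ), k ≤ P.K → HRestrict F N (θ.liveRepin F N).εbg P.K k (domAltOfRecord F N (θ.liveRepin F N).ν P.K k))
    (huniq : ∀ (P : B12.RunParams) (k : ℕ), k ≤ P.K → ∀ V ∈ domAltOfRecord F N (θ.liveRepin F N).ν P.K k, ∀ j < k,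
      UniqueUkOrbit F N P.K (j + 1) (θ.liveRepin F N).εbg (Averaging.iter (avOfRecord F N P.K) (j + 1) (Uk F N P.K k (θ.liveRepin F N).εbg V)))
    (h10 : ∀ P : B12.RunParams, B9LeafX ((θ.liveRepin F N).res.Y P) →
      (B10.Thm1PrintedCompact ((θ.liveRepin F N).res.X P).runs10 ∧ B10.Thm2Printed ((θ.liveRepin F N).res.X P).runs10) →
        B11Leaf ((θ.liveRepin F N).res.Z P) → B12Sec2to5.Lemma4Printed ((θ.liveRepin F N).res.X P).F12 ((θ.liveRepin F N).res.X P).c12 →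
          B13.Lemma1Printed ((θ.liveRepin F N).res.X P).S13 ((θ.liveRepin F N).res.X P).c13 ∧
            B13.Lemma2Printed ((θ.liveRepin F N).res.X P).S13 ((θ.liveRepin F N).res.X P).c13 ∧
              B13.Lemma3Printed ((θ.liveRepin F N).res.X P).S13 ((θ.liveRepin F N).res.X P).c13)
    (h11 : ∀ P : B12.RunParams, (leavesP w P).b7 → (leavesP w P).b8 → (leavesP w P).b9 → (leavesP w P).b10 → (leavesP w P).b11 →
      (leavesP w P).smallCouplings → (leavesP w P).smallFieldInductive → (leavesP w P).flowControl →
        ∀ k, k < P.K → SLaw₁₂ F N (θ.liveRepin F N) P k → TLaw₁₂ F N (θ.liveRepin F N) P k)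
    (h12 : ∀ P : B12.RunParams, B15Leaf ((θ.liveRepin F N).res.W P))
    (hUV : ∀ P : B12.RunParams, (genFlow (betaOfRecord₁₀ F N (θ.liveRepin F N).toStage9Params) P.g0).InInterval w.γ P.K →
      ∀ k, k ≤ P.K → SLaw₁₂ F N (θ.liveRepin F N) P k → ∀ U : GaugeField (F.P P.K) k (SU N),
        chiFixed7 F N (θ.liveRepin F N).ν P.K (gOfRecord₁₀ F N (θ.liveRepin F N).toStage9Params P) k U *
              Real.exp (-(1 / (gOfRecord₁₀ F N (θ.liveRepin F N).toStage9Params P k) ^ 2 * wilsonBGOfRecord F N (θ.liveRepin F N).εbg P k U)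
                - w.em (gOfRecord₁₀ F N (θ.liveRepin F N).toStage9Params P k) * (Fintype.card (Site (F.P P.K) k) : ℝ)) ≤
            densOfRecord₁₀ F N (θ.liveRepin F N).toStage9Params P k U ∧
        densOfRecord₁₀ F N (θ.liveRepin F N).toStage9Params P k U ≤
          Real.exp (w.ep (gOfRecord₁₀ F N (θ.liveRepin F N).toStage9Params P k) * (Fintype.card (Site (F.P P.K) k) : ℝ))) :
    IsRecordOfRecord₁₂C F N (datumOfRecord₁₂ F N (θ.liveRepin F N) hP) w ∧ ∀ P : B12.RunParams, Nodes (leavesP w P) :=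
  N24_nodes₁₂_pointed_all (θ.liveRepin F N) hP hθ.liveRepin w hC hγ hL hup h05 h06 h07 h08 h09 h11dom hres huniq h10 h11 h12
    (fun P k hk => (rOpLeaf_VOfRecord₁₂_iff F N (θ.liveRepin F N) P).1 (rOpLeaf_VOfRecord₁₂_liveRepin_signFree F N θ P hP hθ hκ hE₀ hB₀) k hk) hUV

/-- **N24 · (B2) AT THE DATUM OF A LIVE RE-PIN FROM THE POINTED CHILDREN AND THE β-BOX PAIR — N13's (R₁₂) DISCHARGED BY NAME** (module 32's
`N24_endStatementBPrinted₁₂_pointed_all` at `θ.liveRepin`).  COMPOSITE: (B2) GIVEN the displayed children; nothing of Bałaban's asserted.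
[cite: Balaban1989LargeFieldII, Thm 1 p.355, (0.1) pp.355–356, p.391; Balaban1988Convergent, p.244, Thm 2 p.263; Balaban1989LargeFieldI, (0.3) p.176; Balaban1987RG1, (1.22) p.264 (bookkeeping at the re-pinned presentation)] -/
theorem N24_endStatementBPrinted₁₂_pointed_all_liveRepin (θ : Stage12Params F N) (hP : (θ.liveRepin F N).Provisos₁₂ F N) (hθ : θ.Admissible F N)
    (hκ : 0 ≤ θ.s2.lf.κ) (hE₀ : 0 ≤ θ.s2.lf.E₀) (hB₀ : 0 ≤ θ.s2.lf.B₀) (w : WorldP)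
    (hC : w.C = (datumOfRecord₁₂ F N (θ.liveRepin F N) hP).C) (hγ : 0 < w.γ ∧ w.γ ≤ (θ.liveRepin F N).γ) (hL : w.L = ((θ.liveRepin F N).L : ℝ))
    (hup : ∀ P, w.up P = upOfRecord₅C F N ((θ.liveRepin F N).toStage5₁₂ F N) P)
    (h05 : ∀ P : B12.RunParams,
      B8LeafR ((θ.liveRepin F N).res.X P).d8 ((θ.liveRepin F N).res.X P).L8 ((θ.liveRepin F N).res.X P).C₂ ((θ.liveRepin F N).res.X P).B₁'
        ((θ.liveRepin F N).res.X P).B₀' ((θ.liveRepin F N).res.X P).B₁ ((θ.liveRepin F N).res.X P).B₂ ((θ.liveRepin F N).res.X P).c₁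
        ((θ.liveRepin F N).res.X P).inp8 ((θ.liveRepin F N).res.X P).B₀β ((θ.liveRepin F N).res.X P).loc8 ((θ.liveRepin F N).res.X P).fam8R
        ((θ.liveRepin F N).res.X P).lan8 ((θ.liveRepin F N).res.X P).cub8 ((θ.liveRepin F N).res.X P).toAxial8)
    (h06 : ∀ P : B12.RunParams, B9LeafX ((θ.liveRepin F N).res.Y P))
    (h07 : ∀ P : B12.RunParams, B11Leaf ((θ.liveRepin F N).res.Z P))
    (h08 : ∀ P : B12.RunParams, ∃ (Xc : PrintedCarriersR) (I : Type) (C : B10Assembly.Consts) (T : I → B10.TowerRun),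
      Nonempty (∀ i, B10Assembly.LeafSystem C (T i)) ∧ (θ.liveRepin F N).res.X P = Xc.withTowerRuns10 T)
    (h09 : ∀ P : B12.RunParams, B12Sec2to5.Lemma4Printed ((θ.liveRepin F N).res.X P).F12 ((θ.liveRepin F N).res.X P).c12)
    (h11dom : ∀ (P : B12.RunParams) (k : ℕ), k ≤ P.K →
      ∀ V ∈ domAltOfRecord F N (θ.liveRepin F N).ν P.K k, UkExists F N P.K k (θ.liveRepin F N).εbg V ∧ UniqueUkOrbit F N P.K k (θ.liveRepin F N).εbg V)
    (hres : ∀ (P : B12.RunParams) (k : ℕ), k ≤ P.K → HRestrict F N (θ.liveRepin F N).εbg P.K k (domAltOfRecord F N (θ.liveRepin F N).ν P.K k))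
    (huniq : ∀ (P : B12.RunParams) (k : ℕ), k ≤ P.K → ∀ V ∈ domAltOfRecord F N (θ.liveRepin F N).ν P.K k, ∀ j < k,
      UniqueUkOrbit F N P.K (j + 1) (θ.liveRepin F N).εbg (Averaging.iter (avOfRecord F N P.K) (j + 1) (Uk F N P.K k (θ.liveRepin F N).εbg V)))
    (h10 : ∀ P : B12.RunParams, B9LeafX ((θ.liveRepin F N).res.Y P) →
      (B10.Thm1PrintedCompact ((θ.liveRepin F N).res.X P).runs10 ∧ B10.Thm2Printed ((θ.liveRepin F N).res.X P).runs10) →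
        B11Leaf ((θ.liveRepin F N).res.Z P) → B12Sec2to5.Lemma4Printed ((θ.liveRepin F N).res.X P).F12 ((θ.liveRepin F N).res.X P).c12 →
          B13.Lemma1Printed ((θ.liveRepin F N).res.X P).S13 ((θ.liveRepin F N).res.X P).c13 ∧
            B13.Lemma2Printed ((θ.liveRepin F N).res.X P).S13 ((θ.liveRepin F N).res.X P).c13 ∧
              B13.Lemma3Printed ((θ.liveRepin F N).res.X P).S13 ((θ.liveRepin F N).res.X P).c13)
    (h11 : ∀ P : B12.RunParams, (leavesP w P).b7 → (leavesP w P).b8 → (leavesP w P).b9 → (leavesP w P).b10 → (leavesP w P).b11 →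
      (leavesP w P).smallCouplings → (leavesP w P).smallFieldInductive → (leavesP w P).flowControl →
        ∀ k, k < P.K → SLaw₁₂ F N (θ.liveRepin F N) P k → TLaw₁₂ F N (θ.liveRepin F N) P k)
    (h12 : ∀ P : B12.RunParams, B15Leaf ((θ.liveRepin F N).res.W P))
    (hUV : ∀ P : B12.RunParams, (genFlow (betaOfRecord₁₀ F N (θ.liveRepin F N).toStage9Params) P.g0).InInterval w.γ P.K →
      ∀ k, k ≤ P.K → SLaw₁₂ F N (θ.liveRepin F N) P k → ∀ U : GaugeField (F.P P.K) k (SU N),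
        chiFixed7 F N (θ.liveRepin F N).ν P.K (gOfRecord₁₀ F N (θ.liveRepin F N).toStage9Params P) k U *
              Real.exp (-(1 / (gOfRecord₁₀ F N (θ.liveRepin F N).toStage9Params P k) ^ 2 * wilsonBGOfRecord F N (θ.liveRepin F N).εbg P k U)
                - w.em (gOfRecord₁₀ F N (θ.liveRepin F N).toStage9Params P k) * (Fintype.card (Site (F.P P.K) k) : ℝ)) ≤
            densOfRecord₁₀ F N (θ.liveRepin F N).toStage9Params P k U ∧
        densOfRecord₁₀ F N (θ.liveRepin F N).toStage9Params P k U ≤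
          Real.exp (w.ep (gOfRecord₁₀ F N (θ.liveRepin F N).toStage9Params P k) * (Fintype.card (Site (F.P P.K) k) : ℝ)))
    (hlo : BetaLowerH w.b w.γ (datumOfRecord₁₂ F N (θ.liveRepin F N) hP).βfun) (hhi : BetaUpperH w.βup w.γ (datumOfRecord₁₂ F N (θ.liveRepin F N) hP).βfun) :
    B16.EndStatementBPrinted (datumOfRecord₁₂ F N (θ.liveRepin F N) hP).C :=
  N24_endStatementBPrinted₁₂_pointed_all (θ.liveRepin F N) hP hθ.liveRepin w hC hγ hL hup h05 h06 h07 h08 h09 h11dom hres huniq h10 h11 h12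
    (fun P k hk => (rOpLeaf_VOfRecord₁₂_iff F N (θ.liveRepin F N) P).1 (rOpLeaf_VOfRecord₁₂_liveRepin_signFree F N θ P hP hθ hκ hE₀ hB₀) k hk) hUV hlo hhi

/-- **THE CONSEQUENT OF ITEM K1′ `StabilityBAtRecordR12e` (rev 15, stmt-QuantumFields-19903) WITNESSED BY A LIVE RE-PIN `(θ.liveRepin, hP)`** — module 32's
`N24_stabilityBR12e_thetaShape15_pointed_all` at `θ.liveRepin` with THREE of its displayed inputs DISCHARGED BY NAME: N13's (R₁₂) (seat dag-n11-e's
`rOpLeaf_VOfRecord₁₂_liveRepin_signFree`), `Admissible` (`Stage12Params.Admissible.liveRepin`), and the guard's `SlotsNondegenerate` (node00-def-K0a's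
`Stage12Params.slotsNondegenerate_liveRepin` FROM `hP.base`, the Stage-10 provisos of the re-pin).  Still displayed: `hZ : θ.ZtUnity F N` (the guard's other half; a theorem at K0b's
residuals of record), `θ`'s signs, the world binding, the residual-carrier leaves, N09's inputs, (S1ᵀ), (UV₁₂), the β-box pair.  COMPOSITE: nothing is discharged as a node.
[cite: Balaban1989LargeFieldII, Thm 1 p.355, (0.1) pp.355–356, p.391; Balaban1988Convergent, p.244, Thm 2 p.263, (3.16)–(3.22) pp.268–269, (3.24) p.270; Balaban1989LargeFieldI, (0.3) p.176, p.177 (i)–(ii); Balaban1987RG1, Thm 3 p.264, (0.17)–(0.20) pp.255–256 and (1.22) p.264; Balaban1985Variational, Thm 1 p.279 (bookkeeping + elementary window)] -/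
theorem N24_stabilityBR12e_thetaShape15_pointed_all_liveRepin (θ : Stage12Params F N) (hP : (θ.liveRepin F N).Provisos₁₂ F N) (hθ : θ.Admissible F N)
    (hZ : θ.ZtUnity F N) (hκ : 0 ≤ θ.s2.lf.κ) (hE₀ : 0 ≤ θ.s2.lf.E₀) (hB₀ : 0 ≤ θ.s2.lf.B₀) (w : WorldP)
    (hC : w.C = (datumOfRecord₁₂ F N (θ.liveRepin F N) hP).C) (hγ : 0 < w.γ ∧ w.γ ≤ (θ.liveRepin F N).γ) (hL : w.L = ((θ.liveRepin F N).L : ℝ))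
    (hup : ∀ P, w.up P = upOfRecord₅C F N ((θ.liveRepin F N).toStage5₁₂ F N) P)
    (h05 : ∀ P : B12.RunParams,
      B8LeafR ((θ.liveRepin F N).res.X P).d8 ((θ.liveRepin F N).res.X P).L8 ((θ.liveRepin F N).res.X P).C₂ ((θ.liveRepin F N).res.X P).B₁'
        ((θ.liveRepin F N).res.X P).B₀' ((θ.liveRepin F N).res.X P).B₁ ((θ.liveRepin F N).res.X P).B₂ ((θ.liveRepin F N).res.X P).c₁
        ((θ.liveRepin F N).res.X P).inp8 ((θ.liveRepin F N).res.X P).B₀β ((θ.liveRepin F N).res.X P).loc8 ((θ.liveRepin F N).res.X P).fam8R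
        ((θ.liveRepin F N).res.X P).lan8 ((θ.liveRepin F N).res.X P).cub8 ((θ.liveRepin F N).res.X P).toAxial8)
    (h06 : ∀ P : B12.RunParams, B9LeafX ((θ.liveRepin F N).res.Y P))
    (h07 : ∀ P : B12.RunParams, B11Leaf ((θ.liveRepin F N).res.Z P))
    (h08 : ∀ P : B12.RunParams, ∃ (Xc : PrintedCarriersR) (I : Type) (C : B10Assembly.Consts) (T : I → B10.TowerRun),
      Nonempty (∀ i, B10Assembly.LeafSystem C (T i)) ∧ (θ.liveRepin F N).res.X P = Xc.withTowerRuns10 T)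
    (h09 : ∀ P : B12.RunParams, B12Sec2to5.Lemma4Printed ((θ.liveRepin F N).res.X P).F12 ((θ.liveRepin F N).res.X P).c12)
    (h11dom : ∀ (P : B12.RunParams) (k : ℕ), k ≤ P.K →
      ∀ V ∈ domAltOfRecord F N (θ.liveRepin F N).ν P.K k, UkExists F N P.K k (θ.liveRepin F N).εbg V ∧ UniqueUkOrbit F N P.K k (θ.liveRepin F N).εbg V)
    (hres : ∀ (P : B12.RunParams) (k : ℕ), k ≤ P.K → HRestrict F N (θ.liveRepin F N).εbg P.K k (domAltOfRecord F N (θ.liveRepin F N).ν P.K k))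
    (huniq : ∀ (P : B12.RunParams) (k : ℕ), k ≤ P.K → ∀ V ∈ domAltOfRecord F N (θ.liveRepin F N).ν P.K k, ∀ j < k,
      UniqueUkOrbit F N P.K (j + 1) (θ.liveRepin F N).εbg (Averaging.iter (avOfRecord F N P.K) (j + 1) (Uk F N P.K k (θ.liveRepin F N).εbg V)))
    (h10 : ∀ P : B12.RunParams, B9LeafX ((θ.liveRepin F N).res.Y P) →
      (B10.Thm1PrintedCompact ((θ.liveRepin F N).res.X P).runs10 ∧ B10.Thm2Printed ((θ.liveRepin F N).res.X P).runs10) →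
        B11Leaf ((θ.liveRepin F N).res.Z P) → B12Sec2to5.Lemma4Printed ((θ.liveRepin F N).res.X P).F12 ((θ.liveRepin F N).res.X P).c12 →
          B13.Lemma1Printed ((θ.liveRepin F N).res.X P).S13 ((θ.liveRepin F N).res.X P).c13 ∧
            B13.Lemma2Printed ((θ.liveRepin F N).res.X P).S13 ((θ.liveRepin F N).res.X P).c13 ∧
              B13.Lemma3Printed ((θ.liveRepin F N).res.X P).S13 ((θ.liveRepin F N).res.X P).c13)
    (h11 : ∀ P : B12.RunParams, (leavesP w P).b7 → (leavesP w P).b8 → (leavesP w P).b9 → (leavesP w P).b10 → (leavesP w P).b11 →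
      (leavesP w P).smallCouplings → (leavesP w P).smallFieldInductive → (leavesP w P).flowControl →
        ∀ k, k < P.K → SLaw₁₂ F N (θ.liveRepin F N) P k → TLaw₁₂ F N (θ.liveRepin F N) P k)
    (h12 : ∀ P : B12.RunParams, B15Leaf ((θ.liveRepin F N).res.W P))
    (hUV : ∀ P : B12.RunParams, (genFlow (betaOfRecord₁₀ F N (θ.liveRepin F N).toStage9Params) P.g0).InInterval w.γ P.K →
      ∀ k, k ≤ P.K → SLaw₁₂ F N (θ.liveRepin F N) P k → ∀ U : GaugeField (F.P P.K) k (SU N),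
        chiFixed7 F N (θ.liveRepin F N).ν P.K (gOfRecord₁₀ F N (θ.liveRepin F N).toStage9Params P) k U *
              Real.exp (-(1 / (gOfRecord₁₀ F N (θ.liveRepin F N).toStage9Params P k) ^ 2 * wilsonBGOfRecord F N (θ.liveRepin F N).εbg P k U)
                - w.em (gOfRecord₁₀ F N (θ.liveRepin F N).toStage9Params P k) * (Fintype.card (Site (F.P P.K) k) : ℝ)) ≤
            densOfRecord₁₀ F N (θ.liveRepin F N).toStage9Params P k U ∧
        densOfRecord₁₀ F N (θ.liveRepin F N).toStage9Params P k U ≤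
          Real.exp (w.ep (gOfRecord₁₀ F N (θ.liveRepin F N).toStage9Params P k) * (Fintype.card (Site (F.P P.K) k) : ℝ)))
    (hlo : BetaLowerH w.b w.γ (datumOfRecord₁₂ F N (θ.liveRepin F N) hP).βfun) (hhi : BetaUpperH w.βup w.γ (datumOfRecord₁₂ F N (θ.liveRepin F N) hP).βfun) :
    ∃ (θ' : Stage12Params F N) (h' : θ'.Provisos₁₂ F N), (θ'.ZtUnity F N ∧ θ'.SlotsNondegenerate) ∧ θ'.Admissible F N ∧
      B16.EndStatementBPrinted (datumOfRecord₁₂ F N θ' h').C ∧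
      ∃ γ₁ : ℝ, 0 < γ₁ ∧ ∀ γ : ℝ, 0 < γ → γ ≤ γ₁ → ∃ P : B12.RunParams, 1 ≤ P.K ∧ ((datumOfRecord₁₂ F N θ' h').C P).flow.InInterval γ P.K :=
  N24_stabilityBR12e_thetaShape15_pointed_all (θ.liveRepin F N) hP hθ.liveRepin
    ⟨hZ.liveRepin, Stage12Params.slotsNondegenerate_liveRepin F N θ hP.base⟩ w hC hγ hL hup h05 h06 h07 h08 h09 h11dom hres huniq h10 h11 h12
    (fun P k hk => (rOpLeaf_VOfRecord₁₂_iff F N (θ.liveRepin F N) P).1 (rOpLeaf_VOfRecord₁₂_liveRepin_signFree F N θ P hP hθ hκ hE₀ hB₀) k hk) hUV hlo hhi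

/-! ## §2. At the re-pinned K0′ witness `θ₀ˡⁱᵛᵉ = theta12LiveOfRecord F N ζ Rz Zt` (admissibility and the signs are theorems of the numerics of record) -/

section Theta

variable (ζ : ZetaOfRecord F N numerics7OfRecord₁₂ 1) (Rz : (K : ℕ) → Sect2.Residual (F.P K) (MatA N)) (Zt : (K : ℕ) → TkResidualW F N (FluctV N) K)

/-- **N24 · THE THIRTEEN DAG NODES AT A WORLD BOUND TO THE DATUM OF `θ₀ˡⁱᵛᵉ`, FROM THE POINTED CHILDREN** (§1 at `θ := theta12OfRecord F N ζ Rz Zt`, `θ₀ˡⁱᵛᵉ = θ.liveRepin` by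
`rfl`; admissibility `admissible_theta12OfRecord`, signs `kappa_nonneg_…` ∕ `E0_nonneg_…` ∕ `B0_nonneg_theta12OfRecord`): on the K0′ witness line N13's (R₁₂) costs exactly
`hP : Provisos₁₂` at `θ₀ˡⁱᵛᵉ` (dag-n11-e's `rOpLeaf_VOfRecord₁₂_theta12LiveOfRecord_of_provisos`); displayed — the world binding, the residual-carrier leaves at `θ₀ˡⁱᵛᵉ.res`, N09's
inputs at `domAltOfRecord F N θ₀ˡⁱᵛᵉ.ν`, N10's socket, (S1ᵀ) and (UV₁₂) at `θ₀ˡⁱᵛᵉ`. [cite: Balaban1989LargeFieldII, Thm 1 p.355 (𝐑-construction not exercised), (0.1) pp.355–356, p.391; Balaban1988Convergent, Thm 1 p.262, Theorem p.245, p.244, Thm 2 p.263, (3.16)–(3.22) pp.268–269; Balaban1989LargeFieldI, (0.3) p.176; Balaban1987RG1, Thm 3 p.264, Lemma 4 (3.53) p.280, (0.20)–(0.21) p.256; Balaban1985Variational, Thm 1 p.279; Balaban1985UV3, Thm 1 p.257 + Thm 2 p.272; Balaban1988RG2Cluster, Lemmas 1–3 pp.9, 11, 20 (node bookkeeping at the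 re-pinned witness)] -/
theorem N24_nodes₁₂_pointed_all_theta12Live (hP : (theta12LiveOfRecord F N ζ Rz Zt).Provisos₁₂ F N) (w : WorldP)
    (hC : w.C = (datumOfRecord₁₂ F N (theta12LiveOfRecord F N ζ Rz Zt) hP).C) (hγ : 0 < w.γ ∧ w.γ ≤ (theta12LiveOfRecord F N ζ Rz Zt).γ)
    (hL : w.L = ((theta12LiveOfRecord F N ζ Rz Zt).L : ℝ))
    (hup : ∀ P, w.up P = upOfRecord₅C F N ((theta12LiveOfRecord F N ζ Rz Zt).toStage5₁₂ F N) P)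
    (h05 : ∀ P : B12.RunParams,
      B8LeafR ((theta12LiveOfRecord F N ζ Rz Zt).res.X P).d8 ((theta12LiveOfRecord F N ζ Rz Zt).res.X P).L8 ((theta12LiveOfRecord F N ζ Rz Zt).res.X P).C₂
        ((theta12LiveOfRecord F N ζ Rz Zt).res.X P).B₁' ((theta12LiveOfRecord F N ζ Rz Zt).res.X P).B₀' ((theta12LiveOfRecord F N ζ Rz Zt).res.X P).B₁
        ((theta12LiveOfRecord F N ζ Rz Zt).res.X P).B₂ ((theta12LiveOfRecord F N ζ Rz Zt).res.X P).c₁ ((theta12LiveOfRecord F N ζ Rz Zt).res.X P).inp8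
        ((theta12LiveOfRecord F N ζ Rz Zt).res.X P).B₀β ((theta12LiveOfRecord F N ζ Rz Zt).res.X P).loc8 ((theta12LiveOfRecord F N ζ Rz Zt).res.X P).fam8R
        ((theta12LiveOfRecord F N ζ Rz Zt).res.X P).lan8 ((theta12LiveOfRecord F N ζ Rz Zt).res.X P).cub8 ((theta12LiveOfRecord F N ζ Rz Zt).res.X P).toAxial8)
    (h06 : ∀ P : B12.RunParams, B9LeafX ((theta12LiveOfRecord F N ζ Rz Zt).res.Y P))
    (h07 : ∀ P : B12.RunParams, B11Leaf ((theta12LiveOfRecord F N ζ Rz Zt).res.Z P))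
    (h08 : ∀ P : B12.RunParams, ∃ (Xc : PrintedCarriersR) (I : Type) (C : B10Assembly.Consts) (T : I → B10.TowerRun),
      Nonempty (∀ i, B10Assembly.LeafSystem C (T i)) ∧ (theta12LiveOfRecord F N ζ Rz Zt).res.X P = Xc.withTowerRuns10 T)
    (h09 : ∀ P : B12.RunParams,
      B12Sec2to5.Lemma4Printed ((theta12LiveOfRecord F N ζ Rz Zt).res.X P).F12 ((theta12LiveOfRecord F N ζ Rz Zt).res.X P).c12)
    (h11dom : ∀ (P : B12.RunParams) (k : ℕ), k ≤ P.K → ∀ V ∈ domAltOfRecord F N (theta12LiveOfRecord F N ζ Rz Zt).ν P.K k,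
      UkExists F N P.K k (theta12LiveOfRecord F N ζ Rz Zt).εbg V ∧ UniqueUkOrbit F N P.K k (theta12LiveOfRecord F N ζ Rz Zt).εbg V)
    (hres : ∀ (P : B12.RunParams) (k : ℕ), k ≤ P.K →
      HRestrict F N (theta12LiveOfRecord F N ζ Rz Zt).εbg P.K k (domAltOfRecord F N (theta12LiveOfRecord F N ζ Rz Zt).ν P.K k))
    (huniq : ∀ (P : B12.RunParams) (k : ℕ), k ≤ P.K → ∀ V ∈ domAltOfRecord F N (theta12LiveOfRecord F N ζ Rz Zt).ν P.K k, ∀ j < k,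
      UniqueUkOrbit F N P.K (j + 1) (theta12LiveOfRecord F N ζ Rz Zt).εbg
        (Averaging.iter (avOfRecord F N P.K) (j + 1) (Uk F N P.K k (theta12LiveOfRecord F N ζ Rz Zt).εbg V)))
    (h10 : ∀ P : B12.RunParams, B9LeafX ((theta12LiveOfRecord F N ζ Rz Zt).res.Y P) →
      (B10.Thm1PrintedCompact ((theta12LiveOfRecord F N ζ Rz Zt).res.X P).runs10 ∧
          B10.Thm2Printed ((theta12LiveOfRecord F N ζ Rz Zt).res.X P).runs10) →
        B11Leaf ((theta12LiveOfRecord F N ζ Rz Zt).res.Z P) →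
          B12Sec2to5.Lemma4Printed ((theta12LiveOfRecord F N ζ Rz Zt).res.X P).F12 ((theta12LiveOfRecord F N ζ Rz Zt).res.X P).c12 →
            B13.Lemma1Printed ((theta12LiveOfRecord F N ζ Rz Zt).res.X P).S13 ((theta12LiveOfRecord F N ζ Rz Zt).res.X P).c13 ∧
              B13.Lemma2Printed ((theta12LiveOfRecord F N ζ Rz Zt).res.X P).S13 ((theta12LiveOfRecord F N ζ Rz Zt).res.X P).c13 ∧
                B13.Lemma3Printed ((theta12LiveOfRecord F N ζ Rz Zt).res.X P).S13 ((theta12LiveOfRecord F N ζ Rz Zt).res.X P).c13)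
    (h11 : ∀ P : B12.RunParams, (leavesP w P).b7 → (leavesP w P).b8 → (leavesP w P).b9 → (leavesP w P).b10 → (leavesP w P).b11 →
      (leavesP w P).smallCouplings → (leavesP w P).smallFieldInductive → (leavesP w P).flowControl →
        ∀ k, k < P.K → SLaw₁₂ F N (theta12LiveOfRecord F N ζ Rz Zt) P k → TLaw₁₂ F N (theta12LiveOfRecord F N ζ Rz Zt) P k)
    (h12 : ∀ P : B12.RunParams, B15Leaf ((theta12LiveOfRecord F N ζ Rz Zt).res.W P))
    (hUV : ∀ P : B12.RunParams,
      (genFlow (betaOfRecord₁₀ F N (theta12LiveOfRecord F N ζ Rz Zt).toStage9Params) P.g0).InInterval w.γ P.K →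
      ∀ k, k ≤ P.K → SLaw₁₂ F N (theta12LiveOfRecord F N ζ Rz Zt) P k → ∀ U : GaugeField (F.P P.K) k (SU N),
        chiFixed7 F N (theta12LiveOfRecord F N ζ Rz Zt).ν P.K (gOfRecord₁₀ F N (theta12LiveOfRecord F N ζ Rz Zt).toStage9Params P) k U *
              Real.exp (-(1 / (gOfRecord₁₀ F N (theta12LiveOfRecord F N ζ Rz Zt).toStage9Params P k) ^ 2 *
                  wilsonBGOfRecord F N (theta12LiveOfRecord F N ζ Rz Zt).εbg P k U)
                - w.em (gOfRecord₁₀ F N (theta12LiveOfRecord F N ζ Rz Zt).toStage9Params P k) * (Fintype.card (Site (F.P P.K) k) : ℝ)) ≤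
            densOfRecord₁₀ F N (theta12LiveOfRecord F N ζ Rz Zt).toStage9Params P k U ∧
        densOfRecord₁₀ F N (theta12LiveOfRecord F N ζ Rz Zt).toStage9Params P k U ≤
          Real.exp (w.ep (gOfRecord₁₀ F N (theta12LiveOfRecord F N ζ Rz Zt).toStage9Params P k) * (Fintype.card (Site (F.P P.K) k) : ℝ))) :
    IsRecordOfRecord₁₂C F N (datumOfRecord₁₂ F N (theta12LiveOfRecord F N ζ Rz Zt) hP) w ∧ ∀ P : B12.RunParams, Nodes (leavesP w P) :=
  N24_nodes₁₂_pointed_all_liveRepin (theta12OfRecord F N ζ Rz Zt) hP (admissible_theta12OfRecord F N ζ Rz Zt)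
    (kappa_nonneg_theta12OfRecord F N ζ Rz Zt) (E0_nonneg_theta12OfRecord F N ζ Rz Zt) (B0_nonneg_theta12OfRecord F N ζ Rz Zt)
    w hC hγ hL hup h05 h06 h07 h08 h09 h11dom hres huniq h10 h11 h12 hUV

/-- **THE BODY OF `NodesAtSomeRecord12` WITNESSED BY `θ₀ˡⁱᵛᵉ` AND A WORLD OF ITS DATUM, FROM THE POINTED CHILDREN** (general `N`; at `N := 2` plan g64's text): the guard's
`SlotsNondegenerate` is node00-def-K0a's theorem `slotsNondegenerate_theta12LiveOfRecord` from `hP.base`; `ZtUnity` is displayed as `hZ` (a theorem at K0b's residuals of record,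
`ztUnity_theta12LiveOfRecord`); admissibility is `admissible_theta12LiveOfRecord`.  COMPOSITE: nothing is discharged as a node.
[cite: Balaban1989LargeFieldII, Thm 1 p.355, (0.1) pp.355–356, p.391; Balaban1988Convergent, Thm 1 p.262, (3.16)–(3.22) pp.268–269, (3.24) p.270; Balaban1989LargeFieldI, (0.3)–(0.4) p.176; Balaban1987RG1, Thm 3 p.264 (bookkeeping)] -/
theorem N24_nodesAtSomeRecord₁₂_of_pointed_all_theta12Live (hP : (theta12LiveOfRecord F N ζ Rz Zt).Provisos₁₂ F N)
    (hZ : (theta12LiveOfRecord F N ζ Rz Zt).ZtUnity F N) (w : WorldP)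
    (hC : w.C = (datumOfRecord₁₂ F N (theta12LiveOfRecord F N ζ Rz Zt) hP).C) (hγ : 0 < w.γ ∧ w.γ ≤ (theta12LiveOfRecord F N ζ Rz Zt).γ)
    (hL : w.L = ((theta12LiveOfRecord F N ζ Rz Zt).L : ℝ))
    (hup : ∀ P, w.up P = upOfRecord₅C F N ((theta12LiveOfRecord F N ζ Rz Zt).toStage5₁₂ F N) P)
    (h05 : ∀ P : B12.RunParams,
      B8LeafR ((theta12LiveOfRecord F N ζ Rz Zt).res.X P).d8 ((theta12LiveOfRecord F N ζ Rz Zt).res.X P).L8 ((theta12LiveOfRecord F N ζ Rz Zt).res.X P).C₂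
        ((theta12LiveOfRecord F N ζ Rz Zt).res.X P).B₁' ((theta12LiveOfRecord F N ζ Rz Zt).res.X P).B₀' ((theta12LiveOfRecord F N ζ Rz Zt).res.X P).B₁
        ((theta12LiveOfRecord F N ζ Rz Zt).res.X P).B₂ ((theta12LiveOfRecord F N ζ Rz Zt).res.X P).c₁ ((theta12LiveOfRecord F N ζ Rz Zt).res.X P).inp8
        ((theta12LiveOfRecord F N ζ Rz Zt).res.X P).B₀β ((theta12LiveOfRecord F N ζ Rz Zt).res.X P).loc8 ((theta12LiveOfRecord F N ζ Rz Zt).res.X P).fam8R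
        ((theta12LiveOfRecord F N ζ Rz Zt).res.X P).lan8 ((theta12LiveOfRecord F N ζ Rz Zt).res.X P).cub8 ((theta12LiveOfRecord F N ζ Rz Zt).res.X P).toAxial8)
    (h06 : ∀ P : B12.RunParams, B9LeafX ((theta12LiveOfRecord F N ζ Rz Zt).res.Y P))
    (h07 : ∀ P : B12.RunParams, B11Leaf ((theta12LiveOfRecord F N ζ Rz Zt).res.Z P))
    (h08 : ∀ P : B12.RunParams, ∃ (Xc : PrintedCarriersR) (I : Type) (C : B10Assembly.Consts) (T : I → B10.TowerRun),
      Nonempty (∀ i, B10Assembly.LeafSystem C (T i)) ∧ (theta12LiveOfRecord F N ζ Rz Zt).res.X P = Xc.withTowerRuns10 T)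
    (h09 : ∀ P : B12.RunParams,
      B12Sec2to5.Lemma4Printed ((theta12LiveOfRecord F N ζ Rz Zt).res.X P).F12 ((theta12LiveOfRecord F N ζ Rz Zt).res.X P).c12)
    (h11dom : ∀ (P : B12.RunParams) (k : ℕ), k ≤ P.K → ∀ V ∈ domAltOfRecord F N (theta12LiveOfRecord F N ζ Rz Zt).ν P.K k,
      UkExists F N P.K k (theta12LiveOfRecord F N ζ Rz Zt).εbg V ∧ UniqueUkOrbit F N P.K k (theta12LiveOfRecord F N ζ Rz Zt).εbg V)
    (hres : ∀ (P : B12.RunParams) (k : ℕ), k ≤ P.K →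
      HRestrict F N (theta12LiveOfRecord F N ζ Rz Zt).εbg P.K k (domAltOfRecord F N (theta12LiveOfRecord F N ζ Rz Zt).ν P.K k))
    (huniq : ∀ (P : B12.RunParams) (k : ℕ), k ≤ P.K → ∀ V ∈ domAltOfRecord F N (theta12LiveOfRecord F N ζ Rz Zt).ν P.K k, ∀ j < k,
      UniqueUkOrbit F N P.K (j + 1) (theta12LiveOfRecord F N ζ Rz Zt).εbg
        (Averaging.iter (avOfRecord F N P.K) (j + 1) (Uk F N P.K k (theta12LiveOfRecord F N ζ Rz Zt).εbg V)))
    (h10 : ∀ P : B12.RunParams, B9LeafX ((theta12LiveOfRecord F N ζ Rz Zt).res.Y P) →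
      (B10.Thm1PrintedCompact ((theta12LiveOfRecord F N ζ Rz Zt).res.X P).runs10 ∧
          B10.Thm2Printed ((theta12LiveOfRecord F N ζ Rz Zt).res.X P).runs10) →
        B11Leaf ((theta12LiveOfRecord F N ζ Rz Zt).res.Z P) →
          B12Sec2to5.Lemma4Printed ((theta12LiveOfRecord F N ζ Rz Zt).res.X P).F12 ((theta12LiveOfRecord F N ζ Rz Zt).res.X P).c12 →
            B13.Lemma1Printed ((theta12LiveOfRecord F N ζ Rz Zt).res.X P).S13 ((theta12LiveOfRecord F N ζ Rz Zt).res.X P).c13 ∧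
              B13.Lemma2Printed ((theta12LiveOfRecord F N ζ Rz Zt).res.X P).S13 ((theta12LiveOfRecord F N ζ Rz Zt).res.X P).c13 ∧
                B13.Lemma3Printed ((theta12LiveOfRecord F N ζ Rz Zt).res.X P).S13 ((theta12LiveOfRecord F N ζ Rz Zt).res.X P).c13)
    (h11 : ∀ P : B12.RunParams, (leavesP w P).b7 → (leavesP w P).b8 → (leavesP w P).b9 → (leavesP w P).b10 → (leavesP w P).b11 →
      (leavesP w P).smallCouplings → (leavesP w P).smallFieldInductive → (leavesP w P).flowControl →
        ∀ k, k < P.K → SLaw₁₂ F N (theta12LiveOfRecord F N ζ Rz Zt) P k → TLaw₁₂ F N (theta12LiveOfRecord F N ζ Rz Zt) P k)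
    (h12 : ∀ P : B12.RunParams, B15Leaf ((theta12LiveOfRecord F N ζ Rz Zt).res.W P))
    (hUV : ∀ P : B12.RunParams,
      (genFlow (betaOfRecord₁₀ F N (theta12LiveOfRecord F N ζ Rz Zt).toStage9Params) P.g0).InInterval w.γ P.K →
      ∀ k, k ≤ P.K → SLaw₁₂ F N (theta12LiveOfRecord F N ζ Rz Zt) P k → ∀ U : GaugeField (F.P P.K) k (SU N),
        chiFixed7 F N (theta12LiveOfRecord F N ζ Rz Zt).ν P.K (gOfRecord₁₀ F N (theta12LiveOfRecord F N ζ Rz Zt).toStage9Params P) k U *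
              Real.exp (-(1 / (gOfRecord₁₀ F N (theta12LiveOfRecord F N ζ Rz Zt).toStage9Params P k) ^ 2 *
                  wilsonBGOfRecord F N (theta12LiveOfRecord F N ζ Rz Zt).εbg P k U)
                - w.em (gOfRecord₁₀ F N (theta12LiveOfRecord F N ζ Rz Zt).toStage9Params P k) * (Fintype.card (Site (F.P P.K) k) : ℝ)) ≤
            densOfRecord₁₀ F N (theta12LiveOfRecord F N ζ Rz Zt).toStage9Params P k U ∧
        densOfRecord₁₀ F N (theta12LiveOfRecord F N ζ Rz Zt).toStage9Params P k U ≤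
          Real.exp (w.ep (gOfRecord₁₀ F N (theta12LiveOfRecord F N ζ Rz Zt).toStage9Params P k) * (Fintype.card (Site (F.P P.K) k) : ℝ))) :
    ∃ (θ' : Stage12Params F N) (h' : θ'.Provisos₁₂ F N) (w' : WorldP), (θ'.ZtUnity F N ∧ θ'.SlotsNondegenerate) ∧ θ'.Admissible F N ∧
      IsRecordOfRecord₁₂C F N (datumOfRecord₁₂ F N θ' h') w' ∧ ∀ P : B12.RunParams, Nodes (leavesP w' P) := by
  obtain ⟨hrec, hn⟩ := N24_nodes₁₂_pointed_all_theta12Live ζ Rz Zt hP w hC hγ hL hup h05 h06 h07 h08 h09 h11dom hres huniq h10 h11 h12 hUV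
  exact ⟨_, hP, w, ⟨hZ, slotsNondegenerate_theta12LiveOfRecord F N ζ Rz Zt hP.base⟩, admissible_theta12LiveOfRecord F N ζ Rz Zt, hrec, hn⟩

/-- **★ THE CONSEQUENT OF ITEM K1′ `StabilityBAtRecordR12e` (rev 15, stmt-QuantumFields-19903) WITNESSED BY `(θ₀ˡⁱᵛᵉ, hP)`, FROM THE POINTED CHILDREN AND THE β-BOX PAIR —
N13's (R₁₂), `Admissible` and `SlotsNondegenerate` DISCHARGED BY NAME** (§1 at `θ := theta12OfRecord F N ζ Rz Zt`).  WHICH CHILD BLOCKS ON THE K0′ WITNESS LINE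
(kernel form = this hypothesis list): `hP` (= K0′'s residual at the witness), `hZ` (`ZtUnity`; a theorem at K0b's residuals of record), the world binding, N05 ∕ N06 ∕
N07 ∕ N08 ∕ N12 leaves at `θ₀ˡⁱᵛᵉ.res`, N09's own leaf + [B11] Thm 1 ×3, N10's socket, N11's (S1ᵀ), N13's (UV₁₂), the β-box pair (β⁺ [I] p. 264; `b > 0` NODE O,
UNPRINTED).  COMPOSITE: nothing is discharged as a node. [cite: Balaban1989LargeFieldII, Thm 1 p.355, (0.1) pp.355–356, p.391; Balaban1988Convergent, p.244, Thm 2 p.263, (3.16)–(3.22) pp.268–269, (3.24) p.270; Balaban1989LargeFieldI, (0.3)–(0.4) p.176; Balaban1987RG1, Thm 3 p.264, (0.17)–(0.21) pp.255–256 and (1.22) p.264; Balaban1985Variational, Thm 1 p.279 (bookkeeping + elementary window)] -/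
theorem N24_stabilityBR12e_thetaShape15_pointed_all_theta12Live (hP : (theta12LiveOfRecord F N ζ Rz Zt).Provisos₁₂ F N)
    (hZ : (theta12LiveOfRecord F N ζ Rz Zt).ZtUnity F N) (w : WorldP)
    (hC : w.C = (datumOfRecord₁₂ F N (theta12LiveOfRecord F N ζ Rz Zt) hP).C) (hγ : 0 < w.γ ∧ w.γ ≤ (theta12LiveOfRecord F N ζ Rz Zt).γ)
    (hL : w.L = ((theta12LiveOfRecord F N ζ Rz Zt).L : ℝ))
    (hup : ∀ P, w.up P = upOfRecord₅C F N ((theta12LiveOfRecord F N ζ Rz Zt).toStage5₁₂ F N) P)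
    (h05 : ∀ P : B12.RunParams,
      B8LeafR ((theta12LiveOfRecord F N ζ Rz Zt).res.X P).d8 ((theta12LiveOfRecord F N ζ Rz Zt).res.X P).L8 ((theta12LiveOfRecord F N ζ Rz Zt).res.X P).C₂
        ((theta12LiveOfRecord F N ζ Rz Zt).res.X P).B₁' ((theta12LiveOfRecord F N ζ Rz Zt).res.X P).B₀' ((theta12LiveOfRecord F N ζ Rz Zt).res.X P).B₁
        ((theta12LiveOfRecord F N ζ Rz Zt).res.X P).B₂ ((theta12LiveOfRecord F N ζ Rz Zt).res.X P).c₁ ((theta12LiveOfRecord F N ζ Rz Zt).res.X P).inp8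
        ((theta12LiveOfRecord F N ζ Rz Zt).res.X P).B₀β ((theta12LiveOfRecord F N ζ Rz Zt).res.X P).loc8 ((theta12LiveOfRecord F N ζ Rz Zt).res.X P).fam8R
        ((theta12LiveOfRecord F N ζ Rz Zt).res.X P).lan8 ((theta12LiveOfRecord F N ζ Rz Zt).res.X P).cub8 ((theta12LiveOfRecord F N ζ Rz Zt).res.X P).toAxial8)
    (h06 : ∀ P : B12.RunParams, B9LeafX ((theta12LiveOfRecord F N ζ Rz Zt).res.Y P))
    (h07 : ∀ P : B12.RunParams, B11Leaf ((theta12LiveOfRecord F N ζ Rz Zt).res.Z P))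
    (h08 : ∀ P : B12.RunParams, ∃ (Xc : PrintedCarriersR) (I : Type) (C : B10Assembly.Consts) (T : I → B10.TowerRun),
      Nonempty (∀ i, B10Assembly.LeafSystem C (T i)) ∧ (theta12LiveOfRecord F N ζ Rz Zt).res.X P = Xc.withTowerRuns10 T)
    (h09 : ∀ P : B12.RunParams,
      B12Sec2to5.Lemma4Printed ((theta12LiveOfRecord F N ζ Rz Zt).res.X P).F12 ((theta12LiveOfRecord F N ζ Rz Zt).res.X P).c12)
    (h11dom : ∀ (P : B12.RunParams) (k : ℕ), k ≤ P.K → ∀ V ∈ domAltOfRecord F N (theta12LiveOfRecord F N ζ Rz Zt).ν P.K k,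
      UkExists F N P.K k (theta12LiveOfRecord F N ζ Rz Zt).εbg V ∧ UniqueUkOrbit F N P.K k (theta12LiveOfRecord F N ζ Rz Zt).εbg V)
    (hres : ∀ (P : B12.RunParams) (k : ℕ), k ≤ P.K →
      HRestrict F N (theta12LiveOfRecord F N ζ Rz Zt).εbg P.K k (domAltOfRecord F N (theta12LiveOfRecord F N ζ Rz Zt).ν P.K k))
    (huniq : ∀ (P : B12.RunParams) (k : ℕ), k ≤ P.K → ∀ V ∈ domAltOfRecord F N (theta12LiveOfRecord F N ζ Rz Zt).ν P.K k, ∀ j < k,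
      UniqueUkOrbit F N P.K (j + 1) (theta12LiveOfRecord F N ζ Rz Zt).εbg
        (Averaging.iter (avOfRecord F N P.K) (j + 1) (Uk F N P.K k (theta12LiveOfRecord F N ζ Rz Zt).εbg V)))
    (h10 : ∀ P : B12.RunParams, B9LeafX ((theta12LiveOfRecord F N ζ Rz Zt).res.Y P) →
      (B10.Thm1PrintedCompact ((theta12LiveOfRecord F N ζ Rz Zt).res.X P).runs10 ∧
          B10.Thm2Printed ((theta12LiveOfRecord F N ζ Rz Zt).res.X P).runs10) →
        B11Leaf ((theta12LiveOfRecord F N ζ Rz Zt).res.Z P) →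
          B12Sec2to5.Lemma4Printed ((theta12LiveOfRecord F N ζ Rz Zt).res.X P).F12 ((theta12LiveOfRecord F N ζ Rz Zt).res.X P).c12 →
            B13.Lemma1Printed ((theta12LiveOfRecord F N ζ Rz Zt).res.X P).S13 ((theta12LiveOfRecord F N ζ Rz Zt).res.X P).c13 ∧
              B13.Lemma2Printed ((theta12LiveOfRecord F N ζ Rz Zt).res.X P).S13 ((theta12LiveOfRecord F N ζ Rz Zt).res.X P).c13 ∧
                B13.Lemma3Printed ((theta12LiveOfRecord F N ζ Rz Zt).res.X P).S13 ((theta12LiveOfRecord F N ζ Rz Zt).res.X P).c13)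
    (h11 : ∀ P : B12.RunParams, (leavesP w P).b7 → (leavesP w P).b8 → (leavesP w P).b9 → (leavesP w P).b10 → (leavesP w P).b11 →
      (leavesP w P).smallCouplings → (leavesP w P).smallFieldInductive → (leavesP w P).flowControl →
        ∀ k, k < P.K → SLaw₁₂ F N (theta12LiveOfRecord F N ζ Rz Zt) P k → TLaw₁₂ F N (theta12LiveOfRecord F N ζ Rz Zt) P k)
    (h12 : ∀ P : B12.RunParams, B15Leaf ((theta12LiveOfRecord F N ζ Rz Zt).res.W P))
    (hUV : ∀ P : B12.RunParams,
      (genFlow (betaOfRecord₁₀ F N (theta12LiveOfRecord F N ζ Rz Zt).toStage9Params) P.g0).InInterval w.γ P.K →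
      ∀ k, k ≤ P.K → SLaw₁₂ F N (theta12LiveOfRecord F N ζ Rz Zt) P k → ∀ U : GaugeField (F.P P.K) k (SU N),
        chiFixed7 F N (theta12LiveOfRecord F N ζ Rz Zt).ν P.K (gOfRecord₁₀ F N (theta12LiveOfRecord F N ζ Rz Zt).toStage9Params P) k U *
              Real.exp (-(1 / (gOfRecord₁₀ F N (theta12LiveOfRecord F N ζ Rz Zt).toStage9Params P k) ^ 2 *
                  wilsonBGOfRecord F N (theta12LiveOfRecord F N ζ Rz Zt).εbg P k U)
                - w.em (gOfRecord₁₀ F N (theta12LiveOfRecord F N ζ Rz Zt).toStage9Params P k) * (Fintype.card (Site (F.P P.K) k) : ℝ)) ≤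
            densOfRecord₁₀ F N (theta12LiveOfRecord F N ζ Rz Zt).toStage9Params P k U ∧
        densOfRecord₁₀ F N (theta12LiveOfRecord F N ζ Rz Zt).toStage9Params P k U ≤
          Real.exp (w.ep (gOfRecord₁₀ F N (theta12LiveOfRecord F N ζ Rz Zt).toStage9Params P k) * (Fintype.card (Site (F.P P.K) k) : ℝ)))
    (hlo : BetaLowerH w.b w.γ (datumOfRecord₁₂ F N (theta12LiveOfRecord F N ζ Rz Zt) hP).βfun)
    (hhi : BetaUpperH w.βup w.γ (datumOfRecord₁₂ F N (theta12LiveOfRecord F N ζ Rz Zt) hP).βfun) :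
    ∃ (θ' : Stage12Params F N) (h' : θ'.Provisos₁₂ F N), (θ'.ZtUnity F N ∧ θ'.SlotsNondegenerate) ∧ θ'.Admissible F N ∧
      B16.EndStatementBPrinted (datumOfRecord₁₂ F N θ' h').C ∧
      ∃ γ₁ : ℝ, 0 < γ₁ ∧ ∀ γ : ℝ, 0 < γ → γ ≤ γ₁ → ∃ P : B12.RunParams, 1 ≤ P.K ∧ ((datumOfRecord₁₂ F N θ' h').C P).flow.InInterval γ P.K :=
  N24_stabilityBR12e_thetaShape15_pointed_all_liveRepin (theta12OfRecord F N ζ Rz Zt) hP (admissible_theta12OfRecord F N ζ Rz Zt) hZ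
    (kappa_nonneg_theta12OfRecord F N ζ Rz Zt) (E0_nonneg_theta12OfRecord F N ζ Rz Zt) (B0_nonneg_theta12OfRecord F N ζ Rz Zt)
    w hC hγ hL hup h05 h06 h07 h08 h09 h11dom hres huniq h10 h11 h12 hUV hlo hhi

end Theta

end Literature.MathematicalPhysics.QuantumFieldTheory.Balaban1983to89.Node00

end
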